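import Summits.AtomisticToContinuum.Crystallization.Theorems.ChessboardParticlePlanesPeriodicWindowsRotHull
import Summits.AtomisticToContinuum.Crystallization.Theorems.GappedShellCensusCleanLimitsHaveWindowsMinimalRecurrent
import Literature.MathematicalPhysics.StatisticalMechanics.LocalMatchingCompactness

/-!
# Crux `PeriodicWindows` (stmt-AtomisticToContinuum-3240), line `dense-laminar-hull` — stub P1
# `stub_recurrentHullPoint` (a dense laminar separated rotated-hull point can be taken rooted and
# rooted-uniformly recurrent)

Pure compactness/minimality. Given a `ρ₀`-dense, exactly laminar (distinct heights `≥ 3/4`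
apart), `7/10`-separated point `X` of the ROTATED HULL of a sequence `x` of finite
configurations (local two-way matching limits `BallMatch ε R 0 (range (A j (x (σ j) ·) + τ j)) X`
along a strictly increasing `σ`), we produce such a point `Z` which moreover contains `0` and is
rooted-uniformly recurrent.

Proof. The family `𝒞` of ROOTED (`0 ∈ Z`) dense laminar separated rotated-hull points is
* non-empty: re-root `X` at one of its points (`rotHull_image` with `B = refl`, `v = -p`;
  density, laminarity and separation are translation invariant);
* closed under re-rooting `Z ↦ Z - z`, `z ∈ Z` (the same computation);
* closed under rooted separated local limits: hull membership by
  `rotHull_of_eventually_ballMatch`; density because approximate density passes through the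
  matching and the finitely many points of the (separated) limit near `c` contain a closest one
  (`finite_of_forall_le_dist_of_subset_closedBall`); laminarity because coordinates are
  `1`-Lipschitz (`PiLp.dist_apply_le`), so a pair of heights of `Z` at distance in `(0, 3/4)`
  would be matched to such a pair in some `Zs k`.
Hence the landed abstract minimality theorem `CleanHull.stub_minimalRecurrent` (Birkhoff:
minimal sets are uniformly recurrent, in the local matching topology) applies with `δ = 7/10`.
-/

noncomputable section

namespace Summit.AtomisticToContinuum.Crystallization.Theorems.PeriodicWindowsDenseLaminarHull

open Literature.MathematicalPhysics.StatisticalMechanics Filter Metric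

/-- Coordinates are `1`-Lipschitz: `|p l - q l| ≤ dist p q` in `ℝ³`. -/
private theorem abs_sub_apply_le_dist (p q : EuclideanSpace ℝ (Fin 3)) (l : Fin 3) :
    |p l - q l| ≤ dist p q := by
  rw [← Real.dist_eq]
  exact PiLp.dist_apply_le p q l

/-- **Re-rooting.** Re-rooting `Z ↦ Z - z` at a point `z ∈ Z` of a `ρ₀`-dense, exactly laminar,
`7/10`-separated point of the rotated hull of `x` gives a ROOTED such point (hull membership by
`rotHull_image` with the identity isometry and the translation `-z`; density, laminarity and
separation are translation invariant). -/
private theorem reroot (x : (N : ℕ) → (Fin N → EuclideanSpace ℝ (Fin 3))) {ρ₀ : ℝ}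
    {Z : Set (EuclideanSpace ℝ (Fin 3))}
    (hH : ∃ (σ : ℕ → ℕ) (τ : ℕ → EuclideanSpace ℝ (Fin 3))
        (A : ℕ → (EuclideanSpace ℝ (Fin 3) ≃ₗᵢ[ℝ] EuclideanSpace ℝ (Fin 3))),
      StrictMono σ ∧ ∀ R ε : ℝ, 0 < ε → ∀ᶠ j in Filter.atTop,
        BallMatch ε R 0 (Set.range fun i => A j (x (σ j) i) + τ j) Z)
    (hd : ∀ c : EuclideanSpace ℝ (Fin 3), ∃ p ∈ Z, dist p c ≤ ρ₀)
    (hl : ∀ p ∈ Z, ∀ q ∈ Z, p 2 ≠ q 2 → (3 : ℝ) / 4 ≤ |p 2 - q 2|)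
    (hs : ∀ p ∈ Z, ∀ q ∈ Z, p ≠ q → (7 : ℝ) / 10 ≤ dist p q)
    {z : EuclideanSpace ℝ (Fin 3)} (hz : z ∈ Z) :
    (0 : EuclideanSpace ℝ (Fin 3)) ∈ (fun p => p - z) '' Z ∧
    (∃ (σ : ℕ → ℕ) (τ : ℕ → EuclideanSpace ℝ (Fin 3))
        (A : ℕ → (EuclideanSpace ℝ (Fin 3) ≃ₗᵢ[ℝ] EuclideanSpace ℝ (Fin 3))),
      StrictMono σ ∧ ∀ R ε : ℝ, 0 < ε → ∀ᶠ j in Filter.atTop,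
        BallMatch ε R 0 (Set.range fun i => A j (x (σ j) i) + τ j) ((fun p => p - z) '' Z)) ∧
    (∀ c : EuclideanSpace ℝ (Fin 3), ∃ p ∈ (fun p => p - z) '' Z, dist p c ≤ ρ₀) ∧
    (∀ p ∈ (fun p => p - z) '' Z, ∀ q ∈ (fun p => p - z) '' Z, p 2 ≠ q 2 →
      (3 : ℝ) / 4 ≤ |p 2 - q 2|) ∧
    (∀ p ∈ (fun p => p - z) '' Z, ∀ q ∈ (fun p => p - z) '' Z, p ≠ q →
      (7 : ℝ) / 10 ≤ dist p q) := by
  refine ⟨⟨z, hz, sub_self z⟩, ?_, ?_, ?_, ?_⟩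
  · -- hull membership: `Z - z` is the image of `Z` under `p ↦ refl p + (-z)`
    have heq : (fun p : EuclideanSpace ℝ (Fin 3) =>
        (LinearIsometryEquiv.refl ℝ (EuclideanSpace ℝ (Fin 3))) p + -z) = fun p => p - z := by
      funext p
      simp [sub_eq_add_neg]
    have h := PeriodicWindowsSketch.rotHull_image x hH
      (LinearIsometryEquiv.refl ℝ (EuclideanSpace ℝ (Fin 3))) (-z)
    rw [heq] at h
    exact h
  · -- density
    intro c
    obtain ⟨p, hp, hpc⟩ := hd (c + z)
    refine ⟨p - z, ⟨p, hp, rfl⟩, ?_⟩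
    rwa [dist_sub_eq_dist_add_left]
  · -- laminarity
    rintro _ ⟨p, hp, rfl⟩ _ ⟨q, hq, rfl⟩ hpq
    have e : (p - z) 2 - (q - z) 2 = p 2 - q 2 := by
      simp only [PiLp.sub_apply]
      ring
    have hpq' : p 2 ≠ q 2 := fun h => hpq (by simp only [PiLp.sub_apply, h])
    have h34 := hl p hp q hq hpq'
    dsimp only
    rwa [e]
  · -- separation
    rintro _ ⟨p, hp, rfl⟩ _ ⟨q, hq, rfl⟩ hpq
    have hpq' : p ≠ q := fun h => hpq (by simp only [h])
    have h7 := hs p hp q hq hpq'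
    dsimp only
    rwa [dist_sub_right]

/-- **Density passes to local limits of separated sets.** If every `Zs k` is `ρ₀`-dense,
`Zs k → Z` locally and `Z` is `δ`-separated (`δ > 0`), then `Z` is `ρ₀`-dense: approximate
density passes through the matching, and among the finitely many points of `Z` within `ρ₀ + 1`
of `c` there is a closest one. -/
private theorem dense_of_limit {ρ₀ δ : ℝ} (hδ : 0 < δ) {Zs : ℕ → Set (EuclideanSpace ℝ (Fin 3))}
    {Z : Set (EuclideanSpace ℝ (Fin 3))}
    (hd : ∀ k, ∀ c : EuclideanSpace ℝ (Fin 3), ∃ p ∈ Zs k, dist p c ≤ ρ₀)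
    (hZsep : ∀ p ∈ Z, ∀ q ∈ Z, p ≠ q → δ ≤ dist p q)
    (hlim : ∀ R ε : ℝ, 0 < ε → ∀ᶠ k in atTop, BallMatch ε R 0 (Zs k) Z) :
    ∀ c : EuclideanSpace ℝ (Fin 3), ∃ p ∈ Z, dist p c ≤ ρ₀ := by
  intro c
  -- approximate density, through the matching
  have happrox : ∀ ε : ℝ, 0 < ε → ∃ s ∈ Z, dist s c ≤ ρ₀ + ε := by
    intro ε hε
    obtain ⟨k, hB⟩ := (hlim (‖c‖ + ρ₀) ε hε).exists
    obtain ⟨p, hp, hpc⟩ := hd k c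
    have hpR : dist p 0 ≤ ‖c‖ + ρ₀ :=
      calc dist p 0 ≤ dist p c + dist c 0 := dist_triangle _ _ _
        _ ≤ ρ₀ + ‖c‖ := add_le_add hpc (dist_zero_right c).le
        _ = ‖c‖ + ρ₀ := add_comm _ _
    obtain ⟨s, hs, hps⟩ := hB.2 p hp hpR
    refine ⟨s, hs, ?_⟩
    calc dist s c ≤ dist p s + dist p c := dist_triangle_left _ _ _
      _ ≤ ε + ρ₀ := add_le_add hps hpc
      _ = ρ₀ + ε := add_comm _ _
  -- the finitely many points of `Z` near `c` contain a closest one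
  have hfin : (Z ∩ closedBall c (ρ₀ + 1)).Finite :=
    finite_of_forall_le_dist_of_subset_closedBall hδ
      (fun p hp q hq hpq => hZsep p hp.1 q hq.1 hpq) Set.inter_subset_right
  obtain ⟨s₁, hs₁, hs₁c⟩ := happrox 1 one_pos
  have hne : (Z ∩ closedBall c (ρ₀ + 1)).Nonempty := ⟨s₁, hs₁, mem_closedBall.2 hs₁c⟩
  obtain ⟨s₀, hs₀, hmin⟩ := Set.exists_min_image _ (fun s => dist s c) hfin hne
  refine ⟨s₀, hs₀.1, le_of_forall_pos_le_add fun ε hε => ?_⟩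
  obtain ⟨s, hs, hsc⟩ := happrox (min ε 1) (lt_min hε one_pos)
  have hsS : s ∈ Z ∩ closedBall c (ρ₀ + 1) :=
    ⟨hs, mem_closedBall.2 (hsc.trans (by linarith [min_le_right ε 1]))⟩
  calc dist s₀ c ≤ dist s c := hmin s hsS
    _ ≤ ρ₀ + min ε 1 := hsc
    _ ≤ ρ₀ + ε := by linarith [min_le_left ε 1]

/-- **Exact laminarity passes to local limits.** If every `Zs k` is exactly laminar (distinct
heights at least `3/4` apart) and `Zs k → Z` locally, then `Z` is exactly laminar: two heights
of `Z` at distance in `(0, 3/4)` would be matched, with small error, to two such heights of some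
`Zs k` (coordinates are `1`-Lipschitz). -/
private theorem laminar_of_limit {Zs : ℕ → Set (EuclideanSpace ℝ (Fin 3))}
    {Z : Set (EuclideanSpace ℝ (Fin 3))}
    (hlam : ∀ k, ∀ p ∈ Zs k, ∀ q ∈ Zs k, p 2 ≠ q 2 → (3 : ℝ) / 4 ≤ |p 2 - q 2|)
    (hlim : ∀ R ε : ℝ, 0 < ε → ∀ᶠ k in atTop, BallMatch ε R 0 (Zs k) Z) :
    ∀ p ∈ Z, ∀ q ∈ Z, p 2 ≠ q 2 → (3 : ℝ) / 4 ≤ |p 2 - q 2| := by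
  intro p hp q hq hpq
  by_contra hlt
  rw [not_le] at hlt
  have hd0 : 0 < |p 2 - q 2| := abs_pos.2 (sub_ne_zero.2 hpq)
  obtain ⟨ε, hε0, hε1, hε2⟩ : ∃ ε : ℝ, 0 < ε ∧ ε ≤ |p 2 - q 2| / 4 ∧
      ε ≤ (3 / 4 - |p 2 - q 2|) / 4 :=
    ⟨min (|p 2 - q 2| / 4) ((3 / 4 - |p 2 - q 2|) / 4), lt_min (by linarith) (by linarith),
      min_le_left _ _, min_le_right _ _⟩
  obtain ⟨k, hB⟩ := (hlim (max ‖p‖ ‖q‖) ε hε0).exists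
  obtain ⟨a, ha, hap⟩ := hB.1 p hp (by rw [dist_zero_right]; exact le_max_left _ _)
  obtain ⟨b, hb, hbq⟩ := hB.1 q hq (by rw [dist_zero_right]; exact le_max_right _ _)
  have h3 := abs_le.1 ((abs_sub_apply_le_dist a p 2).trans hap)
  have h4 := abs_le.1 ((abs_sub_apply_le_dist b q 2).trans hbq)
  by_cases hab : a 2 = b 2
  · have : |p 2 - q 2| ≤ 2 * ε := abs_sub_le_iff.2 ⟨by linarith, by linarith⟩
    linarith
  · have h5 := hlam k a ha b hb hab
    have : |a 2 - b 2| ≤ |p 2 - q 2| + 2 * ε :=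
      abs_sub_le_iff.2
        ⟨by linarith [le_abs_self (p 2 - q 2)], by linarith [neg_abs_le (p 2 - q 2)]⟩
    linarith

/-- STUB P1 (compactness/minimality only): a `ρ₀`-dense, exactly laminar, `7/10`-separated point
of the rotated hull of `x` may be replaced by one which is moreover ROOTED (`0 ∈ Z`) and
rooted-uniformly recurrent. The family `𝒞` of rooted dense laminar separated rotated-hull
points is non-empty (re-root `X` at one of its points), closed under re-rooting (`reroot`) and
closed under rooted separated local limits (`rotHull_of_eventually_ballMatch`, `dense_of_limit`,
`laminar_of_limit`), so the abstract minimality theorem `CleanHull.stub_minimalRecurrent`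
applies with `δ = 7/10`. -/
theorem stub_recurrentHullPoint : ∀ ρ₀ : ℝ, 0 < ρ₀ → ∀ x : (N : ℕ) → (Fin N → EuclideanSpace ℝ (Fin 3)),
    (∃ X : Set (EuclideanSpace ℝ (Fin 3)),
      (∃ (σ : ℕ → ℕ) (τ : ℕ → EuclideanSpace ℝ (Fin 3))
          (A : ℕ → (EuclideanSpace ℝ (Fin 3) ≃ₗᵢ[ℝ] EuclideanSpace ℝ (Fin 3))),
        StrictMono σ ∧ ∀ R ε : ℝ, 0 < ε → ∀ᶠ j in Filter.atTop,
          BallMatch ε R 0 (Set.range fun i => A j (x (σ j) i) + τ j) X) ∧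
      (∀ c : EuclideanSpace ℝ (Fin 3), ∃ p ∈ X, dist p c ≤ ρ₀) ∧
      (∀ p ∈ X, ∀ q ∈ X, p 2 ≠ q 2 → (3 : ℝ) / 4 ≤ |p 2 - q 2|) ∧
      (∀ p ∈ X, ∀ q ∈ X, p ≠ q → (7 : ℝ) / 10 ≤ dist p q)) →
    ∃ Z : Set (EuclideanSpace ℝ (Fin 3)), (0 : EuclideanSpace ℝ (Fin 3)) ∈ Z ∧
      (∃ (σ : ℕ → ℕ) (τ : ℕ → EuclideanSpace ℝ (Fin 3))
          (A : ℕ → (EuclideanSpace ℝ (Fin 3) ≃ₗᵢ[ℝ] EuclideanSpace ℝ (Fin 3))),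
        StrictMono σ ∧ ∀ R ε : ℝ, 0 < ε → ∀ᶠ j in Filter.atTop,
          BallMatch ε R 0 (Set.range fun i => A j (x (σ j) i) + τ j) Z) ∧
      (∀ c : EuclideanSpace ℝ (Fin 3), ∃ p ∈ Z, dist p c ≤ ρ₀) ∧
      (∀ p ∈ Z, ∀ q ∈ Z, p 2 ≠ q 2 → (3 : ℝ) / 4 ≤ |p 2 - q 2|) ∧
      (∀ p ∈ Z, ∀ q ∈ Z, p ≠ q → (7 : ℝ) / 10 ≤ dist p q) ∧
      (∀ R ε : ℝ, 0 < ε → ∃ G : ℝ, ∀ w ∈ Z, ∃ g ∈ Z, dist g w ≤ G ∧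
        BallMatch ε R 0 ((fun p => p - g) '' Z) Z) := by
  intro ρ₀ _ x hX
  obtain ⟨X, hXh, hXd, hXl, hXs⟩ := hX
  -- the family of rooted dense laminar separated rotated-hull points
  let 𝒞 : Set (Set (EuclideanSpace ℝ (Fin 3))) := {Z | (0 : EuclideanSpace ℝ (Fin 3)) ∈ Z ∧
    (∃ (σ : ℕ → ℕ) (τ : ℕ → EuclideanSpace ℝ (Fin 3))
        (A : ℕ → (EuclideanSpace ℝ (Fin 3) ≃ₗᵢ[ℝ] EuclideanSpace ℝ (Fin 3))),
      StrictMono σ ∧ ∀ R ε : ℝ, 0 < ε → ∀ᶠ j in Filter.atTop,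
        BallMatch ε R 0 (Set.range fun i => A j (x (σ j) i) + τ j) Z) ∧
    (∀ c : EuclideanSpace ℝ (Fin 3), ∃ p ∈ Z, dist p c ≤ ρ₀) ∧
    (∀ p ∈ Z, ∀ q ∈ Z, p 2 ≠ q 2 → (3 : ℝ) / 4 ≤ |p 2 - q 2|) ∧
    (∀ p ∈ Z, ∀ q ∈ Z, p ≠ q → (7 : ℝ) / 10 ≤ dist p q)}
  have hδ : (0 : ℝ) < 7 / 10 := by norm_num
  have hne : 𝒞.Nonempty := by
    obtain ⟨p, hp, -⟩ := hXd 0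
    exact ⟨_, reroot x hXh hXd hXl hXs hp⟩
  have hsep : ∀ Z ∈ 𝒞, ∀ p ∈ Z, ∀ q ∈ Z, p ≠ q → (7 : ℝ) / 10 ≤ dist p q :=
    fun Z hZ => hZ.2.2.2.2
  have h0 : ∀ Z ∈ 𝒞, (0 : EuclideanSpace ℝ (Fin 3)) ∈ Z := fun Z hZ => hZ.1
  have hroot : ∀ Z ∈ 𝒞, ∀ z ∈ Z, (fun p => p - z) '' Z ∈ 𝒞 :=
    fun Z hZ z hz => reroot x hZ.2.1 hZ.2.2.1 hZ.2.2.2.1 hZ.2.2.2.2 hz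
  have hclosed : ∀ Zs : ℕ → Set (EuclideanSpace ℝ (Fin 3)), (∀ k, Zs k ∈ 𝒞) →
      ∀ Z : Set (EuclideanSpace ℝ (Fin 3)), (0 : EuclideanSpace ℝ (Fin 3)) ∈ Z →
        (∀ p ∈ Z, ∀ q ∈ Z, p ≠ q → (7 : ℝ) / 10 ≤ dist p q) →
        (∀ R ε : ℝ, 0 < ε → ∀ᶠ k in Filter.atTop, BallMatch ε R 0 (Zs k) Z) → Z ∈ 𝒞 := by
    intro Zs hZs Z hZ0 hZsep hlim
    exact ⟨hZ0,
      PeriodicWindowsSketch.rotHull_of_eventually_ballMatch x (fun k => (hZs k).2.1) hlim,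
      dense_of_limit hδ (fun k => (hZs k).2.2.1) hZsep hlim,
      laminar_of_limit (fun k => (hZs k).2.2.2.1) hlim, hZsep⟩
  obtain ⟨Z, hZ𝒞, hrec⟩ :=
    CleanHull.stub_minimalRecurrent (7 / 10) hδ 𝒞 hne hsep h0 hroot hclosed
  exact ⟨Z, hZ𝒞.1, hZ𝒞.2.1, hZ𝒞.2.2.1, hZ𝒞.2.2.2.1, hZ𝒞.2.2.2.2, hrec⟩

end Summit.AtomisticToContinuum.Crystallization.Theorems.PeriodicWindowsDenseLaminarHull

end
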